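import Summits.AtomisticToContinuum.Crystallization.Theorems.ExcessDecayLiouvilleLatticeParam
import Summits.AtomisticToContinuum.Crystallization.Theorems.ExcessDecayLiouvilleDiscreteSobolev1D

/-!
# Route `ExcessDecayLiouville`: nearest-neighbour paths on the two-lattice (long-range differences, part I)

Combinatorial half of the localised long-range estimate `Σ_{p∈B_R} Σ_{|p−q|≤L} |p−q|⁻⁸‖v p − v q‖² ≲ Σ_{NN pairs
in B_{R′}} ‖v p − v q‖²` used by the comparison step of item `ExcessDecay` (stmt-AtomisticToContinuum-9334),
harmonic-replacement architecture.  Sites are labelled by `Fin 2 × ℤ³` through `exists_siteParam`; a MOVE is one of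
twelve label steps realised by nearest-neighbour pairs (`move_dist_le`: in-plane `±u₁, ±u₂` inside a sublattice, the
cross hops `(0,ζ) ↔ (1,ζ)` and `(1,ζ) ↔ (0,ζ+e₃)`), a PATH of length `n` is a chain of moves.  We prove:

* `reach_*` : every label `(m′, ζ)` is reached from `(m, 0)` by a path of length `≤ |i| + |j| + 2|k| + 2`
  (`exists_path`), and paths stay within `11n/10` of their start (`dist_path_le`);
* `sum_path_sq_le` : along a path of length `n`, summed over a finite set of base points,
  `Σ_b ‖v(start_b) − v(end_b)‖² ≤ n · Σ_{s<n} Σ_b ‖v(x_s(b)) − v(x_{s+1}(b))‖²` (telescoping + Cauchy–Schwarz),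
  each inner sum being a sum over DISTINCT nearest-neighbour pairs (`path_step_injective`).

All `[folklore]`; helper lemmas, nothing here closes an item.
-/

noncomputable section

namespace Summit.AtomisticToContinuum.Crystallization.Theorems.ExcessDecayLiouville

open scoped BigOperators Topology InnerProductSpace RealInnerProductSpace Classical
open Literature.MathematicalPhysics.StatisticalMechanics
open Summit.AtomisticToContinuum.Crystallization.Theorems.PhononStabilityNegative
open Summit.AtomisticToContinuum.Crystallization.Theorems

-- lattice vector with integer coordinates
local notation "𝐳[" i ", " j ", " k "]" =>
  (((i : ℤ) : ℝ) • (triangularVec₁ 1 : EuclideanSpace ℝ (Fin 3)) + ((j : ℤ) : ℝ) • triangularVec₂ 1 +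
    ((k : ℤ) : ℝ) • layerNormal (2 * Real.sqrt (2 / 3)))

-- the twelve moves `(m, m', Δζ)`
local notation "𝕄" => (({((0 : Fin 2), (0 : Fin 2), ((1 : ℤ), (0 : ℤ), (0 : ℤ))), (0, 0, (-1, 0, 0)), (0, 0, (0, 1, 0)), (0, 0, (0, -1, 0)),
    (1, 1, (1, 0, 0)), (1, 1, (-1, 0, 0)), (1, 1, (0, 1, 0)), (1, 1, (0, -1, 0)),
    (0, 1, (0, 0, 0)), (1, 0, (0, 0, 0)), (1, 0, (0, 0, 1)), (0, 1, (0, 0, -1))} :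
      Finset (Fin 2 × Fin 2 × ℤ × ℤ × ℤ)))

set_option quotPrecheck false in
-- `Mv[ℓ, ℓ']` : the step from label `ℓ` to label `ℓ'` is a move
local notation "Mv[" ℓ ", " ℓ' "]" => (((ℓ : Fin 2 × ℤ × ℤ × ℤ).1, (ℓ' : Fin 2 × ℤ × ℤ × ℤ).1,
  (ℓ' : Fin 2 × ℤ × ℤ × ℤ).2 - (ℓ : Fin 2 × ℤ × ℤ × ℤ).2) ∈ 𝕄)

set_option quotPrecheck false in
-- `Reach[n, ℓ, ℓ']` : there is a path of length `n` from `ℓ` to `ℓ'`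
local notation "Reach[" n ", " ℓ ", " ℓ' "]" => (∃ γ : ℕ → Fin 2 × ℤ × ℤ × ℤ, γ 0 = ℓ ∧ γ n = ℓ' ∧
  ∀ s < n, Mv[γ s, γ (s + 1)])

/-! ## Reachability -/

/-- Moves are invariant under translation of both labels by a lattice vector. [folklore] -/
theorem move_translate {ℓ ℓ' : Fin 2 × ℤ × ℤ × ℤ} (ξ : ℤ × ℤ × ℤ) (h : Mv[ℓ, ℓ']) :
    Mv[((ℓ.1, ℓ.2 + ξ) : Fin 2 × ℤ × ℤ × ℤ), ((ℓ'.1, ℓ'.2 + ξ) : Fin 2 × ℤ × ℤ × ℤ)] := by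
  have : ℓ'.2 + ξ - (ℓ.2 + ξ) = ℓ'.2 - ℓ.2 := by abel
  simpa only [this] using h

/-- A single move is a path of length one. [folklore] -/
theorem reach_one {ℓ ℓ' : Fin 2 × ℤ × ℤ × ℤ} (h : Mv[ℓ, ℓ']) : Reach[1, ℓ, ℓ'] := by
  refine ⟨fun s => if s = 0 then ℓ else ℓ', by simp, by simp, fun s hs => ?_⟩
  have : s = 0 := by omega
  subst this
  simpa using h

/-- A move listed in `𝕄`, applied at a label of the right sublattice, is a path of length one to the
translated label. [folklore] -/
theorem reach_one_of_mem {ℓ : Fin 2 × ℤ × ℤ × ℤ} {mv : Fin 2 × Fin 2 × ℤ × ℤ × ℤ} (h : mv ∈ 𝕄) (hm : mv.1 = ℓ.1) :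
    Reach[1, ℓ, ((mv.2.1, ℓ.2 + mv.2.2) : Fin 2 × ℤ × ℤ × ℤ)] := by
  refine reach_one ?_
  have : ℓ.2 + mv.2.2 - ℓ.2 = mv.2.2 := by abel
  rw [this, ← hm]
  exact h

/-- The trivial path. [folklore] -/
theorem reach_zero (ℓ : Fin 2 × ℤ × ℤ × ℤ) : Reach[0, ℓ, ℓ] :=
  ⟨fun _ => ℓ, rfl, rfl, fun s hs => (Nat.not_lt_zero s hs).elim⟩

/-- Concatenation of paths. [folklore] -/
theorem reach_trans {n n' : ℕ} {ℓ ℓ' ℓ'' : Fin 2 × ℤ × ℤ × ℤ} (h : Reach[n, ℓ, ℓ']) (h' : Reach[n', ℓ', ℓ'']) :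
    Reach[n + n', ℓ, ℓ''] := by
  obtain ⟨γ, hγ0, hγn, hγ⟩ := h
  obtain ⟨γ', hγ'0, hγ'n, hγ'⟩ := h'
  refine ⟨fun s => if s ≤ n then γ s else γ' (s - n), by simp [hγ0], ?_, fun s hs => ?_⟩
  · by_cases hn' : n' = 0
    · subst hn'
      simp only [add_zero, le_refl, if_true, hγn]
      exact hγ'0.symm.trans hγ'n
    · have : ¬ n + n' ≤ n := by omega
      simp only [this, if_false, Nat.add_sub_cancel_left, hγ'n]
  · by_cases hs1 : s + 1 ≤ n
    · have hs0 : s ≤ n := by omega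
      simp only [hs0, hs1, if_true]
      exact hγ s (by omega)
    · by_cases hs0 : s ≤ n
      · have hs : s = n := by omega
        subst hs
        simp only [le_refl, if_true, hs1, if_false, hγn]
        have e1 : s + 1 - s = 0 + 1 := by omega
        rw [e1, ← hγ'0]
        exact hγ' 0 (by omega)
      · simp only [hs0, hs1, if_false]
        have e1 : s + 1 - n = (s - n) + 1 := by omega
        rw [e1]
        exact hγ' (s - n) (by omega)

/-- Paths translate. [folklore] -/
theorem reach_translate {n : ℕ} {ℓ ℓ' : Fin 2 × ℤ × ℤ × ℤ} (ξ : ℤ × ℤ × ℤ) (h : Reach[n, ℓ, ℓ']) :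
    Reach[n, ((ℓ.1, ℓ.2 + ξ) : Fin 2 × ℤ × ℤ × ℤ), ((ℓ'.1, ℓ'.2 + ξ) : Fin 2 × ℤ × ℤ × ℤ)] := by
  obtain ⟨γ, hγ0, hγn, hγ⟩ := h
  refine ⟨fun s => ((γ s).1, (γ s).2 + ξ), by simp [hγ0], by simp [hγn], fun s hs => ?_⟩
  exact move_translate ξ (hγ s hs)

/-- In-plane paths along `±u₁` inside a sublattice. [folklore] -/
theorem reach_inplane₁ (m : Fin 2) (i : ℤ) :
    Reach[i.natAbs, ((m, (0, 0, 0)) : Fin 2 × ℤ × ℤ × ℤ), ((m, (i, 0, 0)) : Fin 2 × ℤ × ℤ × ℤ)] := by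
  have hp : ((m, m, ((1 : ℤ), (0 : ℤ), (0 : ℤ))) : Fin 2 × Fin 2 × ℤ × ℤ × ℤ) ∈ 𝕄 := by fin_cases m <;> simp
  have hn : ((m, m, ((-1 : ℤ), (0 : ℤ), (0 : ℤ))) : Fin 2 × Fin 2 × ℤ × ℤ × ℤ) ∈ 𝕄 := by fin_cases m <;> simp
  induction i using Int.induction_on with
  | zero => simpa using reach_zero (m, ((0 : ℤ), (0 : ℤ), (0 : ℤ)))
  | succ i ih =>
    have hstep := reach_one_of_mem (ℓ := ((m, ((i : ℤ), 0, 0)) : Fin 2 × ℤ × ℤ × ℤ)) hp rfl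
    have := reach_trans ih hstep
    have e : (i : ℤ).natAbs + 1 = ((i : ℤ) + 1).natAbs := by omega
    rw [e] at this
    simpa using this
  | pred i ih =>
    have hstep := reach_one_of_mem (ℓ := ((m, (-(i : ℤ), 0, 0)) : Fin 2 × ℤ × ℤ × ℤ)) hn rfl
    have := reach_trans ih hstep
    have e : (-(i : ℤ)).natAbs + 1 = (-(i : ℤ) - 1).natAbs := by omega
    rw [e] at this
    have e2 : (-(i : ℤ) + -1 : ℤ) = -(i : ℤ) - 1 := by ring
    simpa [e2] using this

/-- In-plane paths along `±u₂` inside a sublattice. [folklore] -/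
theorem reach_inplane₂ (m : Fin 2) (j : ℤ) :
    Reach[j.natAbs, ((m, (0, 0, 0)) : Fin 2 × ℤ × ℤ × ℤ), ((m, (0, j, 0)) : Fin 2 × ℤ × ℤ × ℤ)] := by
  have hp : ((m, m, ((0 : ℤ), (1 : ℤ), (0 : ℤ))) : Fin 2 × Fin 2 × ℤ × ℤ × ℤ) ∈ 𝕄 := by fin_cases m <;> simp
  have hn : ((m, m, ((0 : ℤ), (-1 : ℤ), (0 : ℤ))) : Fin 2 × Fin 2 × ℤ × ℤ × ℤ) ∈ 𝕄 := by fin_cases m <;> simp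
  induction j using Int.induction_on with
  | zero => simpa using reach_zero (m, ((0 : ℤ), (0 : ℤ), (0 : ℤ)))
  | succ j ih =>
    have hstep := reach_one_of_mem (ℓ := ((m, (0, (j : ℤ), 0)) : Fin 2 × ℤ × ℤ × ℤ)) hp rfl
    have := reach_trans ih hstep
    have e : (j : ℤ).natAbs + 1 = ((j : ℤ) + 1).natAbs := by omega
    rw [e] at this
    simpa using this
  | pred j ih =>
    have hstep := reach_one_of_mem (ℓ := ((m, (0, -(j : ℤ), 0)) : Fin 2 × ℤ × ℤ × ℤ)) hn rfl
    have := reach_trans ih hstep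
    have e : (-(j : ℤ)).natAbs + 1 = (-(j : ℤ) - 1).natAbs := by omega
    rw [e] at this
    have e2 : (-(j : ℤ) + -1 : ℤ) = -(j : ℤ) - 1 := by ring
    simpa [e2] using this

/-- Vertical double steps through the other sublattice: `(0,ζ) → (1,ζ) → (0,ζ+e₃)` and
`(0,ζ) → (1,ζ−e₃) → (0,ζ−e₃)`. [folklore] -/
theorem reach_vertical (k : ℤ) :
    Reach[2 * k.natAbs, (((0 : Fin 2), (0, 0, 0)) : Fin 2 × ℤ × ℤ × ℤ), (((0 : Fin 2), (0, 0, k)) : Fin 2 × ℤ × ℤ × ℤ)] := by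
  have h01 : (((0 : Fin 2), (1 : Fin 2), ((0 : ℤ), (0 : ℤ), (0 : ℤ))) : Fin 2 × Fin 2 × ℤ × ℤ × ℤ) ∈ 𝕄 := by simp
  have h10u : (((1 : Fin 2), (0 : Fin 2), ((0 : ℤ), (0 : ℤ), (1 : ℤ))) : Fin 2 × Fin 2 × ℤ × ℤ × ℤ) ∈ 𝕄 := by simp
  have h01d : (((0 : Fin 2), (1 : Fin 2), ((0 : ℤ), (0 : ℤ), (-1 : ℤ))) : Fin 2 × Fin 2 × ℤ × ℤ × ℤ) ∈ 𝕄 := by simp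
  have h10 : (((1 : Fin 2), (0 : Fin 2), ((0 : ℤ), (0 : ℤ), (0 : ℤ))) : Fin 2 × Fin 2 × ℤ × ℤ × ℤ) ∈ 𝕄 := by simp
  induction k using Int.induction_on with
  | zero => simpa using reach_zero (((0 : Fin 2), ((0 : ℤ), (0 : ℤ), (0 : ℤ))) : Fin 2 × ℤ × ℤ × ℤ)
  | succ k ih =>
    have h1 := reach_one_of_mem (ℓ := (((0 : Fin 2), (0, 0, (k : ℤ))) : Fin 2 × ℤ × ℤ × ℤ)) h01 rfl
    simp only [Prod.mk_add_mk, add_zero] at h1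
    have h2 := reach_one_of_mem (ℓ := (((1 : Fin 2), (0, 0, (k : ℤ))) : Fin 2 × ℤ × ℤ × ℤ)) h10u rfl
    simp only [Prod.mk_add_mk, add_zero] at h2
    have := reach_trans (reach_trans ih h1) h2
    have e : 2 * (k : ℤ).natAbs + 1 + 1 = 2 * ((k : ℤ) + 1).natAbs := by omega
    rw [e] at this
    exact this
  | pred k ih =>
    have h1 := reach_one_of_mem (ℓ := (((0 : Fin 2), (0, 0, -(k : ℤ))) : Fin 2 × ℤ × ℤ × ℤ)) h01d rfl
    simp only [Prod.mk_add_mk, add_zero] at h1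
    have h2 := reach_one_of_mem (ℓ := (((1 : Fin 2), (0, 0, -(k : ℤ) + -1)) : Fin 2 × ℤ × ℤ × ℤ)) h10 rfl
    simp only [Prod.mk_add_mk, add_zero] at h2
    have := reach_trans (reach_trans ih h1) h2
    have e : 2 * (-(k : ℤ)).natAbs + 1 + 1 = 2 * (-(k : ℤ) - 1).natAbs := by omega
    rw [e] at this
    have e2 : (-(k : ℤ) + -1 : ℤ) = -(k : ℤ) - 1 := by ring
    simpa [e2] using this

/-- **Every label is reached from `(m, 0)` by a short path**: length `≤ |i| + |j| + 2|k| + 2`. [folklore] -/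
theorem exists_path (m m' : Fin 2) (i j k : ℤ) :
    ∃ n : ℕ, n ≤ i.natAbs + j.natAbs + 2 * k.natAbs + 2 ∧
      Reach[n, ((m, (0, 0, 0)) : Fin 2 × ℤ × ℤ × ℤ), ((m', (i, j, k)) : Fin 2 × ℤ × ℤ × ℤ)] := by
  -- start: to sublattice 0
  have hstart : ∃ n₀ : ℕ, n₀ ≤ 1 ∧ Reach[n₀, ((m, (0, 0, 0)) : Fin 2 × ℤ × ℤ × ℤ), (((0 : Fin 2), (0, 0, 0)) : Fin 2 × ℤ × ℤ × ℤ)] := by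
    fin_cases m
    · exact ⟨0, by norm_num, by simpa using reach_zero (((0 : Fin 2), ((0 : ℤ), (0 : ℤ), (0 : ℤ))) : Fin 2 × ℤ × ℤ × ℤ)⟩
    · refine ⟨1, le_rfl, ?_⟩
      have h := reach_one_of_mem (ℓ := (((1 : Fin 2), ((0 : ℤ), (0 : ℤ), (0 : ℤ))) : Fin 2 × ℤ × ℤ × ℤ))
        (mv := (((1 : Fin 2), (0 : Fin 2), ((0 : ℤ), (0 : ℤ), (0 : ℤ))) : Fin 2 × Fin 2 × ℤ × ℤ × ℤ)) (by simp) rfl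
      simpa using h
  -- end: to sublattice m'
  have hend : ∃ n₁ : ℕ, n₁ ≤ 1 ∧ Reach[n₁, (((0 : Fin 2), (i, j, k)) : Fin 2 × ℤ × ℤ × ℤ), ((m', (i, j, k)) : Fin 2 × ℤ × ℤ × ℤ)] := by
    fin_cases m'
    · exact ⟨0, by norm_num, by simpa using reach_zero (((0 : Fin 2), (i, j, k)) : Fin 2 × ℤ × ℤ × ℤ)⟩
    · refine ⟨1, le_rfl, ?_⟩
      have h := reach_one_of_mem (ℓ := (((0 : Fin 2), (i, j, k)) : Fin 2 × ℤ × ℤ × ℤ))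
        (mv := (((0 : Fin 2), (1 : Fin 2), ((0 : ℤ), (0 : ℤ), (0 : ℤ))) : Fin 2 × Fin 2 × ℤ × ℤ × ℤ)) (by simp) rfl
      simpa using h
  obtain ⟨n₀, hn₀, h₀⟩ := hstart
  obtain ⟨n₁, hn₁, h₁⟩ := hend
  have hi := reach_inplane₁ (0 : Fin 2) i
  have hj := reach_translate ((i, 0, 0) : ℤ × ℤ × ℤ) (reach_inplane₂ (0 : Fin 2) j)
  simp only [Prod.mk_add_mk, add_zero, zero_add] at hj
  have hk := reach_translate ((i, j, 0) : ℤ × ℤ × ℤ) (reach_vertical k)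
  simp only [Prod.mk_add_mk, add_zero, zero_add] at hk
  have htot := reach_trans (reach_trans (reach_trans (reach_trans h₀ hi) hj) hk) h₁
  exact ⟨_, by omega, htot⟩

/-- The endpoints of a move are distinct labels. [folklore] -/
theorem ne_of_move {ℓ ℓ' : Fin 2 × ℤ × ℤ × ℤ} (h : Mv[ℓ, ℓ']) : ℓ ≠ ℓ' := by
  rintro rfl
  simp only [sub_self, Finset.mem_insert, Finset.mem_singleton, Prod.mk.injEq] at h
  rcases h with h | h | h | h | h | h | h | h | h | h | h | h <;>
    simp only [Prod.ext_iff, Prod.fst_zero, Prod.snd_zero] at h <;> omega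

section Sites

variable {t : Fin 2 → (EuclideanSpace ℝ (Fin 3))} {A : (EuclideanSpace ℝ (Fin 3)) →L[ℝ] (EuclideanSpace ℝ (Fin 3))}

/-- Additivity of the lattice vector in its (triple of) integer coordinates. [folklore] -/
theorem latticeVec_prod_add (x y : ℤ × ℤ × ℤ) :
    𝐳[(x + y).1, (x + y).2.1, (x + y).2.2] = 𝐳[x.1, x.2.1, x.2.2] + 𝐳[y.1, y.2.1, y.2.2] := by
  simp only [Prod.fst_add, Prod.snd_add]
  exact latticeVec_add _ _ _ _ _ _

/-- **Moves are nearest-neighbour pairs**: for the site parametrisation `e`, a base `b ∈ ℤ³` and a move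
`ℓ → ℓ'`, the sites `e(ℓ.1, b + ℓ.2)` and `e(ℓ'.1, b + ℓ'.2)` are within `11/10`. [folklore] -/
theorem move_dist_le (hA : Adm₀ A) (hI : Inner₀ t A) (e : Fin 2 × ℤ × ℤ × ℤ ≃ Sites₀ t A)
    (he : ∀ m : Fin 2, ∀ i j k : ℤ, ((e (m, i, j, k) : Sites₀ t A) : EuclideanSpace ℝ (Fin 3)) = t m + A 𝐳[i, j, k])
    (b : ℤ × ℤ × ℤ) {ℓ ℓ' : Fin 2 × ℤ × ℤ × ℤ} (h : Mv[ℓ, ℓ']) :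
    dist ((e (ℓ.1, b + ℓ.2) : Sites₀ t A) : EuclideanSpace ℝ (Fin 3)) (e (ℓ'.1, b + ℓ'.2)) ≤ 11 / 10 := by
  obtain ⟨hu₁, hu₂⟩ := norm_apply_triangularVec_le hA
  have hcross := norm_t_sub_t_le hA hI
  have hvert := norm_Aw₃_sub_le hA hI
  -- write ℓ' = (m', ℓ.2 + Δ)
  obtain ⟨m, ζ⟩ := ℓ
  obtain ⟨m', ζ'⟩ := ℓ'
  set Δ : ℤ × ℤ × ℤ := ζ' - ζ with hΔ
  have hζ' : ζ' = ζ + Δ := by rw [hΔ]; abel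
  have he1 : ((e (m, b + ζ) : Sites₀ t A) : EuclideanSpace ℝ (Fin 3)) = t m + A 𝐳[(b + ζ).1, (b + ζ).2.1, (b + ζ).2.2] :=
    he m _ _ _
  have he2 : ((e (m', b + ζ') : Sites₀ t A) : EuclideanSpace ℝ (Fin 3)) =
      t m' + (A 𝐳[(b + ζ).1, (b + ζ).2.1, (b + ζ).2.2] + A 𝐳[Δ.1, Δ.2.1, Δ.2.2]) := by
    rw [he m', hζ', ← add_assoc, latticeVec_prod_add, map_add]
  simp only at he1 he2 ⊢
  rw [dist_eq_norm, he1, he2]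
  have hform : t m + A 𝐳[(b + ζ).1, (b + ζ).2.1, (b + ζ).2.2] -
      (t m' + (A 𝐳[(b + ζ).1, (b + ζ).2.1, (b + ζ).2.2] + A 𝐳[Δ.1, Δ.2.1, Δ.2.2])) =
      (t m - t m') - A 𝐳[Δ.1, Δ.2.1, Δ.2.2] := by abel
  rw [hform]
  simp only [Finset.mem_insert, Finset.mem_singleton, Prod.mk.injEq] at h
  rcases h with ⟨hm, hm', hd⟩ | ⟨hm, hm', hd⟩ | ⟨hm, hm', hd⟩ | ⟨hm, hm', hd⟩ | ⟨hm, hm', hd⟩ | ⟨hm, hm', hd⟩ |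
    ⟨hm, hm', hd⟩ | ⟨hm, hm', hd⟩ | ⟨hm, hm', hd⟩ | ⟨hm, hm', hd⟩ | ⟨hm, hm', hd⟩ | ⟨hm, hm', hd⟩
  all_goals
    subst hm; subst hm'
    simp only [hd, Int.cast_zero, Int.cast_one, Int.cast_neg, zero_smul, one_smul, neg_smul, add_zero, zero_add,
      map_neg, map_zero, sub_zero, sub_self, zero_sub, sub_neg_eq_add, norm_neg]
  · exact hu₁
  · exact hu₁
  · exact hu₂
  · exact hu₂
  · exact hu₁
  · exact hu₁
  · exact hu₂
  · exact hu₂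
  · rw [norm_sub_rev]; exact hcross
  · exact hcross
  · rw [norm_sub_rev]; exact hvert
  · have : t 0 - t 1 + A (layerNormal (2 * Real.sqrt (2 / 3))) = A (layerNormal (2 * Real.sqrt (2 / 3))) - (t 1 - t 0) := by abel
    rw [this]; exact hvert

/-- **Paths stay near their start**: after `s` moves the site is within `11s/10` of the initial site. [folklore] -/
theorem dist_path_le (hA : Adm₀ A) (hI : Inner₀ t A) (e : Fin 2 × ℤ × ℤ × ℤ ≃ Sites₀ t A)
    (he : ∀ m : Fin 2, ∀ i j k : ℤ, ((e (m, i, j, k) : Sites₀ t A) : EuclideanSpace ℝ (Fin 3)) = t m + A 𝐳[i, j, k])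
    (b : ℤ × ℤ × ℤ) {n : ℕ} {γ : ℕ → Fin 2 × ℤ × ℤ × ℤ} (hγ : ∀ s < n, Mv[γ s, γ (s + 1)]) {s : ℕ} (hs : s ≤ n) :
    dist ((e ((γ s).1, b + (γ s).2) : Sites₀ t A) : EuclideanSpace ℝ (Fin 3)) (e ((γ 0).1, b + (γ 0).2)) ≤ 11 / 10 * s := by
  induction s with
  | zero => simp
  | succ s ih =>
    have h1 := ih (by omega)
    have h2 := move_dist_le hA hI e he b (hγ s (by omega))
    have := dist_triangle ((e ((γ (s + 1)).1, b + (γ (s + 1)).2) : Sites₀ t A) : EuclideanSpace ℝ (Fin 3))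
      ((e ((γ s).1, b + (γ s).2) : Sites₀ t A) : EuclideanSpace ℝ (Fin 3)) ((e ((γ 0).1, b + (γ 0).2) : Sites₀ t A) : EuclideanSpace ℝ (Fin 3))
    rw [dist_comm] at h2
    push_cast
    linarith

/-- The step map of a path is injective in the base point. [folklore] -/
theorem path_step_injective (e : Fin 2 × ℤ × ℤ × ℤ ≃ Sites₀ t A) (ℓ : Fin 2 × ℤ × ℤ × ℤ) :
    Function.Injective (fun b : ℤ × ℤ × ℤ => e (ℓ.1, b + ℓ.2)) := by
  intro b b' h
  have := e.injective h
  simp only [Prod.mk.injEq, true_and] at this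
  exact add_right_cancel this

/-- **Telescoping along a path**: for a path `γ` of length `n` and a finite set of base points,
`Σ_b ‖v(x₀(b)) − v(x_n(b))‖² ≤ n · Σ_{s<n} Σ_b ‖v(x_s(b)) − v(x_{s+1}(b))‖²`, `x_s(b) = e((γ s).1, b + (γ s).2)`.
[folklore] -/
theorem sum_path_sq_le (e : Fin 2 × ℤ × ℤ × ℤ ≃ Sites₀ t A) (v : (EuclideanSpace ℝ (Fin 3)) → (EuclideanSpace ℝ (Fin 3)))
    (n : ℕ) (γ : ℕ → Fin 2 × ℤ × ℤ × ℤ) (Bset : Finset (ℤ × ℤ × ℤ)) :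
    ∑ b ∈ Bset, ‖v (e ((γ 0).1, b + (γ 0).2) : Sites₀ t A) - v (e ((γ n).1, b + (γ n).2) : Sites₀ t A)‖ ^ 2 ≤
      n * ∑ s ∈ Finset.range n, ∑ b ∈ Bset,
        ‖v (e ((γ s).1, b + (γ s).2) : Sites₀ t A) - v (e ((γ (s + 1)).1, b + (γ (s + 1)).2) : Sites₀ t A)‖ ^ 2 := by
  rw [Finset.sum_comm, Finset.mul_sum]
  refine Finset.sum_le_sum fun b _ => ?_
  set g : ℕ → EuclideanSpace ℝ (Fin 3) := fun s => v (e ((γ s).1, b + (γ s).2) : Sites₀ t A) with hg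
  have h1 : ‖g 0 - g n‖ ≤ ∑ s ∈ Finset.range n, ‖g (s + 1) - g s‖ := norm_sub_le_sum_diff g (Nat.zero_le n) le_rfl
  have h2 : ‖g 0 - g n‖ ^ 2 ≤ (∑ s ∈ Finset.range n, ‖g (s + 1) - g s‖) ^ 2 := pow_le_pow_left₀ (norm_nonneg _) h1 2
  have h3 := sq_sum_le_card_mul_sum_sq (s := Finset.range n) (f := fun s => ‖g (s + 1) - g s‖)
  rw [Finset.card_range] at h3
  have h4 : ∀ s, ‖g (s + 1) - g s‖ ^ 2 = ‖g s - g (s + 1)‖ ^ 2 := fun s => by rw [norm_sub_rev]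
  simp only [h4] at h3
  exact h2.trans h3

end Sites

end Summit.AtomisticToContinuum.Crystallization.Theorems.ExcessDecayLiouville

end
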